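import Mathlib.Analysis.InnerProductSpace.PiL2
import Mathlib.Geometry.Manifold.Instances.Real
import Mathlib.Geometry.Manifold.Diffeomorph
import Mathlib.Geometry.Manifold.SmoothEmbedding
import Mathlib.Topology.Algebra.Module.FiniteDimensionBilinear
import Literature.Geometry.Lorentzian.KerrSchild
import Literature.Geometry.Lorentzian.Hypersurface
import Literature.Geometry.Lorentzian.InitialData
import Literature.Geometry.Lorentzian.AsymptoticFlatness
import Mathlib.Analysis.InnerProductSpace.Calculus
import HarnessLib

-- provenance: harness21/H21/H21/Prelude/Lorentz/KerrData.lean @ d20076f (interim HEAD d8f2665); M5 mechanical rewrite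
-- D-0014 sorry-free migration + `Kerr.Facts`/`HasLeviCivita`/`hpb` dependency-drift fix (prover-migrate-pool-A-g17-0, 2026-08-13)
/-!
# Kerr–Schild slices of Kerr as asymptotically flat initial data (trunk G08, item C16)

Family `gr`, notions `kerr_schwarzschild_family` (½) and `asymptotic_flatness_adm`; statement id
**gr.S17** ('induced Kerr data'). Feeds the stability statements gr.S04–S06.

In ingoing Kerr–Schild Cartesian coordinates `(t*, x, y, z)` (file `KerrSchild`) the Kerr metric
is `g = η + 2H ℓ ⊗ ℓ` on `Kerr.region a r₀ = {max r₀ 0 < r} ⊆ E4`. The hypersurface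
`{t* = 0} ∩ Kerr.region a r₀`, identified with the open subset
`Kerr.slice a r₀ = {y ∈ E3 | max r₀ 0 < r(a, (0, y))}` of `E3`, is spacelike for `M ≥ 0`
(`g^{00} = −1 − 2H < 0`), horizon-penetrating for `r₀ < r₊`, and carries the induced data
`h = δ + 2H ℓ⃗ ⊗ ℓ⃗` (`ℓ⃗` the spatial part of `ℓ`, `|ℓ⃗|_δ = 1`) and `k = K_ν` (second
fundamental form w.r.t. the future unit normal `ν = −g♯dt* / √(1 + 2H)`, sign convention (h)
of the outline: `K_ν(v, w) = + g(D_v ν, df w)`). These data are asymptotically flat of order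
`1` with ADM energy `M` and vanishing ADM momentum.

Contents (namespace `Literature.Lorentz.Kerr`):
* `Kerr.slice`, `Kerr.sliceEmbed` (`y ↦ (0, y)`), `Kerr.contMDiff_sliceEmbed` (proved),
  `Kerr.smoothMetric` (the Kerr metric as a `C^∞` metric), `Kerr.sliceNormal`, `Kerr.sliceK`,
  the named facts (D-0014) `Kerr.isConnected_slice`, `Kerr.isSmoothEmbedding_sliceEmbed`,
  `Kerr.isFutureUnitNormal_sliceNormal`, `Kerr.isSpacelikeImmersion_sliceEmbed`,
  `Kerr.sliceK_symm`, `Kerr.contMDiff_sliceK`, the `Prop` class `Kerr.SliceFacts` bundling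
  those of them on which the bundled data depend, and `Kerr.data` (**gr.S17**);
* the asymptotically flat end `Kerr.afEnd a r₀` (inclusion chart `{R < ‖y‖} ⊆ slice`,
  `R = √((max r₀ 0)² + a²) + 1`), with `Kerr.mem_slice_of_lt_norm`; the smoothness of both
  chart maps is proved;
* named facts (D-0014; theorems in print): `Kerr.data_isVacuumConstraintSolution`,
  `Kerr.isAsymptoticallyFlat_data` (order `α = 1`), `Kerr.hasADMEnergy_data` (`E_ADM = M`),
  `Kerr.hasADMMomentum_data_zero`, and the *negative* result
  `Kerr.not_isStronglyAsymptoticallyFlatDR_data` (see below); the consequences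
  `Kerr.admEnergy_data`, `Kerr.admMomentum_data_eq_zero`, `Kerr.admMass_data` are proved from
  them (taken as hypotheses).

## Mathlib

Mathlib has no Kerr metric, initial data or ADM notions (`rg -i 'kerr|initial data|ADM mass'
Mathlib/Geometry` is empty). We use `TopologicalSpace.Opens` as open submanifolds, `Diffeomorph`,
`Manifold.IsSmoothEmbedding` (`Mathlib/Geometry/Manifold/SmoothEmbedding.lean`) and
`LinearMap.toContinuousBilinearMap` (`Mathlib/Topology/Algebra/Module/FiniteDimensionBilinear`)
to turn the algebraic second fundamental form into a continuous bilinear form on the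
finite-dimensional fibre `E3`. Everything else comes from the H21 modules `KerrSchild`,
`Hypersurface` (`inducedRiemannianMetric`, `secondFundamentalForm`, `IsFutureUnitNormal`),
`InitialData` (`InitialDataSet`) and `AsymptoticFlatness` (`AFEnd`, decay classes, ADM).

## Design choices

* **Regularity.** `Kerr.metric M a r₀` is analytic (`n = ω`), but `InitialDataSet` bundles a
  `C^∞` Riemannian metric and Mathlib has no regularity-lowering map for
  `Bundle.ContMDiffRiemannianMetric`. We therefore work with
  `Kerr.smoothMetric M a r₀ := (Kerr.metric M a r₀).ofLE le_top : LorentzianMetric 𝓘(ℝ, E4) ∞ _`,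
  which is *by `rfl`* the metric of the bundled `Kerr.spacetime M a r₀ hM`
  (`Kerr.spacetime_metric`), and with the time orientation `(Kerr.timeOrientation M a r₀ hM).ofLE`.
* **Hypothesis `0 ≤ M`.** The induced form `δ + 2H ℓ⃗ ⊗ ℓ⃗` is positive definite iff
  `1 + 2H > 0`, and `ν = −g♯dt*/√(1 + 2H)` is a unit timelike vector iff `1 + 2H > 0`; this holds
  on all of `{r > 0}` iff `0 ≤ M`. Hence `hM : 0 ≤ M` on `isSpacelikeImmersion_sliceEmbed`,
  `isFutureUnitNormal_sliceNormal`, the regularity/symmetry lemmas of `k` and on `Kerr.data`. The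
  *definition* `Kerr.sliceNormal` is total (junk value where `1 + 2H ≤ 0`: `Real.sqrt = 0`,
  `0⁻¹ = 0`, so `ν = 0`; documented).
* **`k` as a continuous bilinear form.** `secondFundamentalForm` is a `LinearMap.BilinForm` on
  `T_y (Kerr.slice a r₀) = E3` (definitionally); `Kerr.sliceK` is its image under Mathlib's
  `LinearMap.toContinuousBilinearMap` (finite-dimensional fibre), so `sliceK_apply` is `rfl`.
* **Not a Cauchy hypersurface (review F5).** The slice `{t* = 0} ∩ {r > max r₀ 0}` is spacelike
  and, for `r₀ < r₊`, horizon-penetrating, but it is **not** a Cauchy hypersurface of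
  `Kerr.region a r₀`: inextendible causal curves can leave the chart region through `{r = r₀}`
  before reaching `{t* = 0}`. All downstream statements use only (maximal globally hyperbolic)
  *developments* of `Kerr.data`, never `Kerr.spacetime` as a development.
* **AF end.** `Kerr.afEnd a r₀` is the tautological end: `U = {y ∈ slice | R < ‖y‖}` with
  `R = √((max r₀ 0)² + a²) + 1`, chart the inclusion into `exteriorRegion R` (a bijection since
  `R < ‖y‖` forces `max r₀ 0 < r`, `Kerr.mem_slice_of_lt_norm`, proved from `r² ≥ ‖y‖² − a²`);
  both inverse laws are `rfl`, closedness at infinity and smoothness of the two chart maps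
  (identity in ambient coordinates, `ContMDiff.subtypeVal_comp_iff`) are proved.
* **M5 migration (D-0014, sorry-free Literature).** The dependencies drifted as follows:
  `Kerr.metric`/`Kerr.timeOrientation`/`Kerr.spacetime` take the instance hypothesis
  `[Kerr.Facts]` (`KerrSchild`); `secondFundamentalForm` takes the standing Levi-Civita
  hypothesis `[g.HasLeviCivita]` and `inducedRiemannianMetric` the smoothness hypothesis
  `hpb : contMDiff_pullbackBilin …` (`Hypersurface`, `Isometry`). Accordingly every declaration
  mentioning the Kerr metric takes `[Kerr.Facts]`; `Kerr.sliceK` and its unfolding lemmas take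
  `[(Kerr.smoothMetric M a r₀).HasLeviCivita]`. The results proved in print but not here are
  named facts `def … : Prop` (hypotheses such as `0 ≤ M` become leading binders of the `Prop`).
  Those on which the *bundled* objects depend — connectedness of the slice (the
  `ConnectedSpace` instance), the pullback-smoothness fact `hpb` for the slice embedding, the
  Levi-Civita fact `isCovariantDerivativeOn_leviCivitaFun` for `Kerr.smoothMetric` (giving the
  instance `Kerr.hasLeviCivita_smoothMetric`), spacelikeness of the slice embedding, symmetry
  and smoothness of `k` — are the fields of the `Prop` class `Kerr.SliceFacts`, taken as the
  instance hypothesis `[Kerr.SliceFacts]` by `Kerr.data` and everything downstream (house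
  pattern `Kerr.Facts`, `SphereEmbedding.SmoothnessFacts`), so that `Kerr.data M a r₀ hM` keeps
  its signature. `Kerr.data_isVacuumConstraintSolution` binds `[(data …).metric.HasLeviCivita]`
  exactly as `Kerr.isRicciFlat` does.
* **Deviation from the outline (strong asymptotic flatness).** The outline planned
  `Kerr.isStronglyAsymptoticallyFlatDR_data : IsStronglyAsymptoticallyFlatDR (afEnd a r₀) (data …) M`
  (flagging a "chart issue"). This statement is **false** for `M ≠ 0`, in the given chart and in
  any chart: on Kerr–Schild slices `tr_h k = (2M/r²)(1 + 3M/r)(1 + 2M/r)^{-3/2} + O(a M r⁻³)`, so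
  `k` is `O(r⁻²)` but not `o(r⁻²)` as `IsSAFWith … 1 2` demands (and already
  `h − (1 + 2M/r)δ = (2M/r)(x̂ ⊗ x̂ − δ) + O(r⁻²)` is not `o(r⁻¹)` in Kerr–Schild Cartesian
  coordinates). We therefore state the true facts: asymptotic flatness of order `1`
  (`Kerr.isAsymptoticallyFlat_data`), `E_ADM = M`, `P_ADM = 0`, and the negative result
  `Kerr.not_isStronglyAsymptoticallyFlatDR_data` for `0 < M`.

## References

* R. P. Kerr, *Gravitational field of a spinning mass as an example of algebraically special
  metrics*, Phys. Rev. Lett. 11 (1963) 237–238.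
* M. Visser, *The Kerr spacetime: a brief introduction*, arXiv:0706.0622, §5, (32)–(35).
* A. García-Parrado Gómez-Lobo, J. A. Valiente Kroon, *Kerr initial data*, J. Geom. Phys. 58
  (2008) 1186–1202 (Kerr–Schild slice data, §5).
* G. B. Cook, *Initial data for numerical relativity*, Living Rev. Relativ. 3 (2000) 5, §3.2.2
  (Kerr–Schild slices: `h = δ + 2H ℓ⃗ℓ⃗`, lapse `(1 + 2H)^{-1/2}`, `tr K`).
* R. Bartnik, *The mass of an asymptotically flat manifold*, CPAM 39 (1986), Thm. 4.2.
* M. Dafermos, I. Rodnianski, *Lectures on black holes and linear waves*, arXiv:0811.0354, §5.1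
  and App. B.2.3.
* M. Dafermos, G. Holzegel, I. Rodnianski, M. Taylor, *The non-linear stability of the
  Schwarzschild family of black holes*, arXiv:2104.08222, §1 (Kerr–Schild-type
  horizon-penetrating data).
-/

noncomputable section

open Bundle TopologicalSpace Manifold
open scoped ContDiff Topology

namespace Literature.Geometry.Lorentzian

namespace Kerr

/-! ### The slice `{t* = 0}` and its embedding -/

/-- The **Kerr–Schild slice** `{t* = 0} ∩ Kerr.region a r₀`, identified with the open subset
`{y ∈ E3 | max r₀ 0 < r(a, (0, y))}` of `E3` (an open submanifold modelled on `𝓘(ℝ, E3) = 𝓡 3`).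
For `max r₀ 0 = m > 0` it is the exterior of the confocal ellipsoid `{r = m}`, for `m = 0` the
complement of the closed disc `{z = 0, ρ ≤ |a|}`. Dafermos–Rodnianski arXiv:0811.0354, §5.1;
García-Parrado–Valiente Kroon, J. Geom. Phys. 58 (2008), §5. [cite: arXiv08110354] -/
def slice (a r₀ : ℝ) : Opens E3 :=
  ⟨{y | max r₀ 0 < radius a (E4.ofTimeSpace 0 y)},
    isOpen_lt continuous_const ((continuous_radius a).comp (E4.continuous_ofTimeSpace 0))⟩

/-- Membership in `Kerr.slice` (Dafermos–Rodnianski arXiv:0811.0354, §5.1). [cite: arXiv08110354] -/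
@[simp]
theorem mem_slice {a r₀ : ℝ} {y : E3} :
    y ∈ slice a r₀ ↔ max r₀ 0 < radius a (E4.ofTimeSpace 0 y) := Iff.rfl

/-- `y ∈ Kerr.slice a r₀ ↔ (0, y) ∈ Kerr.region a r₀` (Dafermos–Rodnianski arXiv:0811.0354,
§5.1). [cite: arXiv08110354] -/
theorem mem_slice_iff_ofTimeSpace_mem_region {a r₀ : ℝ} {y : E3} :
    y ∈ slice a r₀ ↔ E4.ofTimeSpace 0 y ∈ region a r₀ := Iff.rfl

/-- `Kerr.slice a r₀` is nonempty and connected for **all** `a, r₀`: it is the exterior of a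
confocal ellipsoid (`max r₀ 0 > 0`) or the complement of a compact disc in `ℝ³`
(`max r₀ 0 = 0`), diffeomorphic to `(max r₀ 0, ∞) × S²` resp. containing the connected dense
set `{‖y‖ > |a|}`. O'Neill 1995, Ch. 2, §2.1; Dafermos–Rodnianski arXiv:0811.0354, §5.1. Named fact
(D-0014), a field of `Kerr.SliceFacts` (it supplies the `ConnectedSpace` instance of the slice). [cite: ONeill1995, Ch. 2  §2.1] -/
def isConnected_slice (a r₀ : ℝ) : Prop :=
  IsConnected (slice a r₀ : Set E3)

/-- The **slice embedding** `Kerr.slice a r₀ → Kerr.region a r₀`, `y ↦ (0, y)` (inclusion of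
`{t* = 0}`). Dafermos–Rodnianski arXiv:0811.0354, §5.1; García-Parrado–Valiente Kroon 2008,
§5. [cite: Kroon2008, §5] -/
def sliceEmbed (a r₀ : ℝ) : slice a r₀ → region a r₀ :=
  fun y ↦ ⟨E4.ofTimeSpace 0 y, y.2⟩

/-- Unfolding lemma: `sliceEmbed a r₀ y = (0, y)` in `E4` (Dafermos–Rodnianski
arXiv:0811.0354, §5.1). [cite: arXiv08110354] -/
@[simp]
theorem coe_sliceEmbed (a r₀ : ℝ) (y : slice a r₀) :
    (sliceEmbed a r₀ y : E4) = E4.ofTimeSpace 0 y := rfl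

/-- The slice embedding is injective (Dafermos–Rodnianski arXiv:0811.0354, §5.1). [cite: arXiv08110354] -/
theorem sliceEmbed_injective (a r₀ : ℝ) : Function.Injective (sliceEmbed a r₀) := by
  intro y y' h
  exact Subtype.ext (E4.ofTimeSpace_injective 0 (congrArg Subtype.val h))

/-- The slice embedding `y ↦ (0, y)` is a smooth (indeed affine-linear in the ambient
coordinates) embedding of `Kerr.slice a r₀` into `Kerr.region a r₀`, in Mathlib's sense
`Manifold.IsSmoothEmbedding` (immersion + topological embedding). Dafermos–Rodnianski
arXiv:0811.0354, §5.1; Lee, *Introduction to Smooth Manifolds*, Thm. 4.12. Named fact (D-0014;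
the immersion half is Mathlib's chart notion, an instance of the local immersion theorem). [cite: arXiv08110354] -/
def isSmoothEmbedding_sliceEmbed (a r₀ : ℝ) : Prop :=
  Manifold.IsSmoothEmbedding 𝓘(ℝ, E3) 𝓘(ℝ, E4) ∞ (sliceEmbed a r₀)

/-- The map `y ↦ (t, y)`, `E3 → E4`, is `C^n` for every `n` (it is affine: each component is a
constant or a coordinate). Dafermos–Rodnianski arXiv:0811.0354, §5.1. [folklore] -/
theorem _root_.Literature.Geometry.Lorentzian.E4.contMDiff_ofTimeSpace (t : ℝ) (n : ℕ∞ω) :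
    ContMDiff 𝓘(ℝ, E3) 𝓘(ℝ, E4) n (E4.ofTimeSpace t) := by
  rw [contMDiff_iff_contDiff]
  refine contDiff_euclidean.mpr fun i ↦ ?_
  refine Fin.cases ?_ (fun j ↦ ?_) i
  · simpa using contDiff_const
  · simpa using (EuclideanSpace.proj (𝕜 := ℝ) j).contDiff

/-- The slice embedding is `C^∞` (indeed `C^ω`) as a map of manifolds
`Kerr.slice a r₀ → Kerr.region a r₀`, at every regularity `n` (its composite with the inclusion
`Kerr.region a r₀ ⊆ E4` is the restriction of the affine map `y ↦ (0, y)` to an open set).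
Dafermos–Rodnianski arXiv:0811.0354, §5.1. [cite: arXiv08110354] -/
theorem contMDiff_sliceEmbed (a r₀ : ℝ) (n : ℕ∞ω) :
    ContMDiff 𝓘(ℝ, E3) 𝓘(ℝ, E4) n (sliceEmbed a r₀) := fun y ↦
  (ChartedSpace.liftPropWithinAt_subtypeVal_comp_iff (sliceEmbed a r₀) Set.univ y).mp
    (((E4.contMDiff_ofTimeSpace 0 n).comp contMDiff_subtype_val) y)

/-! ### The smooth Kerr metric, the unit normal, spacelikeness -/

/-- The Kerr metric `g_{M,a}` on `Kerr.region a r₀` regarded as a `C^∞` Lorentzian metric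
(`(Kerr.metric M a r₀).ofLE le_top`); this is by `rfl` the metric of the bundled spacetime
`Kerr.spacetime M a r₀ hM` and is the regularity at which `InitialDataSet`, `Development` and
the null-infinity notions are stated; `[Kerr.Facts]` as in `Kerr.metric`. Kerr, PRL 11 (1963);
Dafermos–Rodnianski arXiv:0811.0354, §5.1. [cite: arXiv08110354] -/
abbrev smoothMetric [Facts] (M a r₀ : ℝ) : LorentzianMetric 𝓘(ℝ, E4) ∞ (region a r₀) :=
  (metric M a r₀).ofLE le_top

/-- The metric of `Kerr.spacetime M a r₀ hM` is `Kerr.smoothMetric M a r₀` (by `rfl`).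
Dafermos–Rodnianski arXiv:0811.0354, §5.1. [cite: arXiv08110354] -/
theorem spacetime_metric [Facts] (M a r₀ : ℝ) (hM : 0 ≤ M) :
    (spacetime M a r₀ hM).metric = smoothMetric M a r₀ := rfl

/-- The value of the smooth Kerr metric at `x` is the Kerr–Schild form `Kerr.bilin M a x`
(Kerr–Schild 1965). [cite: KerrSchild1965] -/
@[simp]
theorem smoothMetric_val [Facts] (M a r₀ : ℝ) (x : region a r₀) :
    (smoothMetric M a r₀).val x = bilin M a x.1 := rfl

/-- The **future unit normal** of the slice `{t* = 0}`:
`ν = −g♯(dt*) / √(1 + 2H) = (1 + 2H)^{-1/2} (1 + 2H, −2H ℓ₁, −2H ℓ₂, −2H ℓ₃)` at `(0, y)`, i.e.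
`(√(1 + 2H))⁻¹ • Kerr.timeVector`. Since `g(V, V) = −1 − 2H` for `V = −g♯dt*`, this is a unit
timelike future normal wherever `1 + 2H > 0`, in particular everywhere if `0 ≤ M`
(`isFutureUnitNormal_sliceNormal`). **Junk value** where `1 + 2H ≤ 0` (only possible for
`M < 0`): `Real.sqrt = 0` and `0⁻¹ = 0`, so `ν = 0`. Cook, Living Rev. Relativ. 3 (2000) 5,
§3.2.2 (lapse `α = (1 + 2H)^{-1/2}`, shift `βⁱ = 2H ℓⁱ/(1 + 2H)`); García-Parrado–Valiente Kroon
2008, §5. [folklore] -/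
def sliceNormal (M a r₀ : ℝ) : NormalField 𝓘(ℝ, E4) (sliceEmbed a r₀) :=
  fun y ↦ (√(1 + 2 * scalarH M a (E4.ofTimeSpace 0 y)))⁻¹ • timeVector M a (E4.ofTimeSpace 0 y)

/-- Unfolding lemma for `Kerr.sliceNormal` (Cook 2000, §3.2.2). [cite: Cook2000, §3.2.2] -/
theorem sliceNormal_apply (M a r₀ : ℝ) (y : slice a r₀) :
    sliceNormal M a r₀ y =
      (√(1 + 2 * scalarH M a (E4.ofTimeSpace 0 y)))⁻¹ • timeVector M a (E4.ofTimeSpace 0 y) :=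
  rfl

/-- For `M ≥ 0`, `Kerr.sliceNormal` is the future unit normal of the slice embedding in the
time-oriented Kerr chart: `g(ν, d(sliceEmbed) v) = −(√(1+2H))⁻¹ dt*(0, v) = 0`,
`g(ν, ν) = (−1 − 2H)/(1 + 2H) = −1`, and `g(V, ν) = −√(1 + 2H) < 0`. Cook 2000, §3.2.2;
Wald 1984, §10.2. Named fact (D-0014; the hypothesis `0 ≤ M` is the leading binder). [cite: Cook2000, §3.2.2] -/
def isFutureUnitNormal_sliceNormal [Facts] (M a r₀ : ℝ) : Prop :=
  ∀ hM : 0 ≤ M,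
    (smoothMetric M a r₀).IsFutureUnitNormal 𝓘(ℝ, E3) ((timeOrientation M a r₀ hM).ofLE le_top)
      (sliceEmbed a r₀) (sliceNormal M a r₀)

/-- For `M ≥ 0` the slice embedding `y ↦ (0, y)` is a **spacelike immersion** into
`(Kerr.region a r₀, g_{M,a})`: it is `C^∞` and the induced form is
`h = δ + 2H ℓ⃗ ⊗ ℓ⃗` with `|ℓ⃗|²_δ = ℓ₁² + ℓ₂² + ℓ₃² = 1` (nullity of `ℓ`), whose values on `v ≠ 0`
are `|v|² + 2H (ℓ⃗·v)² ≥ min(1, 1 + 2H) |v|² > 0` as `H ≥ 0`. Cook 2000, §3.2.2, (55);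
García-Parrado–Valiente Kroon 2008, §5; Dafermos–Rodnianski arXiv:0811.0354, §5.1
(`{t* = c}` is spacelike). Named fact (D-0014; `0 ≤ M` is the leading binder), a field of
`Kerr.SliceFacts`. [cite: Cook2000, §3.2.2  (55] -/
def isSpacelikeImmersion_sliceEmbed [Facts] (M a r₀ : ℝ) : Prop :=
  0 ≤ M → (smoothMetric M a r₀).IsSpacelikeImmersion 𝓘(ℝ, E3) (sliceEmbed a r₀)

/-! ### The induced data `(h, k)` -/

/-- The **second fundamental form of the Kerr–Schild slice** at `y`, as a *continuous* bilinear
form on `T_y (Kerr.slice a r₀) = E3`: the image under Mathlib's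
`LinearMap.toContinuousBilinearMap` (finite-dimensional fibre) of
`secondFundamentalForm 𝓘(ℝ, E3) g (sliceEmbed a r₀) (sliceNormal M a r₀) y`, i.e.
`k(v, w) = + g(D_v ν, d(sliceEmbed) w)` with the future unit normal `ν` (sign convention (h);
Wald 1984, (10.2.13)). Explicit component formulas (for `a = 0`:
`k_ij = (2M α / r²) (δ_ij − (2 + M/r) xᵢxⱼ/r²)`, `α = (1 + 2M/r)^{-1/2}`): Cook, Living Rev.
Relativ. 3 (2000) 5, §3.2.2, (56)–(57); García-Parrado–Valiente Kroon 2008, §5. Standing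
hypotheses `[Kerr.Facts]` (the metric) and `[(Kerr.smoothMetric M a r₀).HasLeviCivita]` (the
Levi-Civita connection, `Hypersurface.lean`; supplied by `Kerr.hasLeviCivita_smoothMetric` under
`[Kerr.SliceFacts]`). [cite: Wald1984, (10.2.13] -/
def sliceK [Facts] (M a r₀ : ℝ) [(smoothMetric M a r₀).HasLeviCivita] (y : slice a r₀) :
    TangentSpace 𝓘(ℝ, E3) y →L[ℝ] TangentSpace 𝓘(ℝ, E3) y →L[ℝ] ℝ :=
  show E3 →L[ℝ] E3 →L[ℝ] ℝ from
    LinearMap.toContinuousBilinearMap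
      (show E3 →ₗ[ℝ] E3 →ₗ[ℝ] ℝ from
        (smoothMetric M a r₀).secondFundamentalForm 𝓘(ℝ, E3) (sliceEmbed a r₀)
          (sliceNormal M a r₀) y)

/-- `Kerr.sliceK` is the second fundamental form `K_ν` of `Hypersurface.lean` (by `rfl`).
Wald 1984, (10.2.13). [cite: Wald1984, (10.2.13] -/
@[simp]
theorem sliceK_apply [Facts] (M a r₀ : ℝ) [(smoothMetric M a r₀).HasLeviCivita] (y : slice a r₀)
    (v w : TangentSpace 𝓘(ℝ, E3) y) :
    sliceK M a r₀ y v w =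
      (smoothMetric M a r₀).secondFundamentalForm 𝓘(ℝ, E3) (sliceEmbed a r₀)
        (sliceNormal M a r₀) y v w :=
  rfl

/-- `Kerr.sliceK` as an algebraic bilinear form is the second fundamental form (by `rfl`).
Wald 1984, (10.2.13). [cite: Wald1984, (10.2.13] -/
theorem toLinearMap₁₂_sliceK [Facts] (M a r₀ : ℝ) [(smoothMetric M a r₀).HasLeviCivita]
    (y : slice a r₀) :
    (sliceK M a r₀ y).toLinearMap₁₂ =
      (smoothMetric M a r₀).secondFundamentalForm 𝓘(ℝ, E3) (sliceEmbed a r₀)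
        (sliceNormal M a r₀) y :=
  rfl

/-- For `M ≥ 0` the second fundamental form of the Kerr–Schild slice is symmetric (the normal
`ν` is a genuine smooth unit normal, `secondFundamentalForm_symm`). O'Neill 1983, Ch. 4,
Lemma 4.4; Wald 1984, §10.2. Named fact (D-0014; `0 ≤ M` and the Levi-Civita hypothesis are
leading binders), a field of `Kerr.SliceFacts`. [cite: ONeill1983, Ch. 4  Lemma 4.4] -/
def sliceK_symm [Facts] (M a r₀ : ℝ) : Prop :=
  0 ≤ M → ∀ [(smoothMetric M a r₀).HasLeviCivita] (y : slice a r₀)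
    (v w : TangentSpace 𝓘(ℝ, E3) y), sliceK M a r₀ y v w = sliceK M a r₀ y w v

/-- For `M ≥ 0` the second fundamental form `y ↦ k_y` of the Kerr–Schild slice is a smooth
section of the bundle of bilinear forms on `T(Kerr.slice a r₀)` (its components are rational
functions of `(y, r, √(1 + 2H))` with nonvanishing denominators on `{r > 0}` when `H ≥ 0`).
Cook 2000, §3.2.2, (57); García-Parrado–Valiente Kroon 2008, §5. Named fact (D-0014; `0 ≤ M` and
the Levi-Civita hypothesis are leading binders), a field of `Kerr.SliceFacts`. [cite: Cook2000, §3.2.2  (57] -/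
def contMDiff_sliceK [Facts] (M a r₀ : ℝ) : Prop :=
  0 ≤ M → ∀ [(smoothMetric M a r₀).HasLeviCivita],
    ContMDiff 𝓘(ℝ, E3) (𝓘(ℝ, E3).prod 𝓘(ℝ, E3 →L[ℝ] E3 →L[ℝ] ℝ)) ∞
      (fun y : slice a r₀ ↦ TotalSpace.mk' (E3 →L[ℝ] E3 →L[ℝ] ℝ)
        (E := fun x : slice a r₀ ↦
          TangentSpace 𝓘(ℝ, E3) x →L[ℝ] TangentSpace 𝓘(ℝ, E3) x →L[ℝ] ℝ)
        y (sliceK M a r₀ y))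

/-! ### The named facts on which the bundled data depend -/

/-- The analytic and topological facts about the Kerr–Schild slice `{t* = 0}` that are vendored
as named facts (D-0014) and on which the bundled Kerr initial data set `Kerr.data` depends:
connectedness of `Kerr.slice a r₀` (O'Neill 1995, Ch. 2, §2.1); smoothness of pullbacks of
`C^∞` bilinear forms along `C^∞` maps `Kerr.slice a r₀ → Kerr.region a r₀` (the named fact
`PseudoRiemannianMetric.contMDiff_pullbackBilin` of `Isometry.lean`, O'Neill 1983, Ch. 3,
Lemma 3.35 ff.); existence of the Levi-Civita connection of the smooth Kerr metric (the named
fact `isCovariantDerivativeOn_leviCivitaFun` of `LeviCivita.lean`, O'Neill 1983, Ch. 3,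
Thm. 3.11); spacelikeness of the slice embedding and symmetry and smoothness of its second
fundamental form for `M ≥ 0` (Cook 2000, §3.2.2, (55)–(57); O'Neill 1983, Ch. 4, Lemma 4.4).
A `Prop`-valued class, taken as the instance hypothesis `[Kerr.SliceFacts]` (house pattern:
`Kerr.Facts`, `SphereEmbedding.SmoothnessFacts`) by the `ConnectedSpace` instance of the slice,
`Kerr.hasLeviCivita_smoothMetric`, `Kerr.data` and the statements about it. The fields
mentioning the metric bind `[Kerr.Facts]`. [cite: Cook2000, §3.2.2 (55)–(57); O'Neill 1983 Ch. 3 Thm. 3.11, Ch. 4 Lemma 4.4] -/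
class SliceFacts : Prop where
  /-- `Kerr.slice a r₀` is connected (named fact `Kerr.isConnected_slice`). -/
  isConnected_slice (a r₀ : ℝ) : Kerr.isConnected_slice a r₀
  /-- Pullbacks of `C^∞` bilinear forms along `C^∞` maps `Kerr.slice a r₀ → Kerr.region a r₀`
  are `C^∞` (named fact `PseudoRiemannianMetric.contMDiff_pullbackBilin` of `Isometry.lean`). -/
  contMDiff_pullbackBilin (a r₀ : ℝ) :
    PseudoRiemannianMetric.contMDiff_pullbackBilin 𝓘(ℝ, E4) (region a r₀) 𝓘(ℝ, E3)
      (slice a r₀) ∞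
  /-- The Levi-Civita formula of the smooth Kerr metric is a covariant derivative (named fact
  `PseudoRiemannianMetric.isCovariantDerivativeOn_leviCivitaFun` of `LeviCivita.lean`). -/
  isCovariantDerivativeOn_leviCivitaFun [Facts] (M a r₀ : ℝ) :
    (smoothMetric M a r₀).isCovariantDerivativeOn_leviCivitaFun
  /-- The slice embedding is a spacelike immersion for `0 ≤ M` (named fact
  `Kerr.isSpacelikeImmersion_sliceEmbed`). -/
  isSpacelikeImmersion_sliceEmbed [Facts] (M a r₀ : ℝ) : Kerr.isSpacelikeImmersion_sliceEmbed M a r₀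
  /-- `k` is symmetric for `0 ≤ M` (named fact `Kerr.sliceK_symm`). -/
  sliceK_symm [Facts] (M a r₀ : ℝ) : Kerr.sliceK_symm M a r₀
  /-- `y ↦ k_y` is a smooth section for `0 ≤ M` (named fact `Kerr.contMDiff_sliceK`). -/
  contMDiff_sliceK [Facts] (M a r₀ : ℝ) : Kerr.contMDiff_sliceK M a r₀

/-- `Kerr.slice a r₀` is a connected space, from the named fact `isConnected_slice` (field of
`[Kerr.SliceFacts]`; an instance on our own definition, needed by `Development`). O'Neill 1995,
Ch. 2, §2.1. [cite: ONeill1995, Ch. 2  §2.1] -/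
instance connectedSpace_slice [SliceFacts] (a r₀ : ℝ) : ConnectedSpace (slice a r₀) :=
  isConnected_iff_connectedSpace.mp (SliceFacts.isConnected_slice a r₀)

/-- The smooth Kerr metric carries its Levi-Civita connection: the standing hypothesis
`[(Kerr.smoothMetric M a r₀).HasLeviCivita]` of the Levi-Civita/curvature/hypersurface API,
from the named fact `isCovariantDerivativeOn_leviCivitaFun` (field of `[Kerr.SliceFacts]`) via
`HasLeviCivita.of`. O'Neill 1983, Ch. 3, Thm. 3.11. [cite: ONeill1983, Ch. 3, Thm. 3.11] -/
instance hasLeviCivita_smoothMetric [Facts] [SliceFacts] (M a r₀ : ℝ) :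
    (smoothMetric M a r₀).HasLeviCivita :=
  PseudoRiemannianMetric.HasLeviCivita.of _ (SliceFacts.isCovariantDerivativeOn_leviCivitaFun M a r₀)

/-- **gr.S17** (induced Kerr data; Kerr PRL 11 (1963), O'Neill 1995 Ch. 2, Dafermos–Rodnianski
arXiv:0811.0354 §5.1; García-Parrado–Valiente Kroon, J. Geom. Phys. 58 (2008) §5; Cook, Living
Rev. Relativ. 3 (2000) §3.2.2). The **Kerr initial data set** `(Kerr.slice a r₀, h, k)` induced by
`g_{M,a}`, `M ≥ 0`, on the Kerr–Schild slice `{t* = 0} ∩ {r > max r₀ 0}`: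
`h = (sliceEmbed)^* g = δ + 2H ℓ⃗ ⊗ ℓ⃗` (`inducedRiemannianMetric`) and `k = K_ν` the second
fundamental form w.r.t. the **future** unit normal `ν = Kerr.sliceNormal`, sign convention
`K_ν(v, w) = + g(D_v ν, df w)`. `a = 0` gives Schwarzschild data in ingoing
Eddington–Finkelstein slicing; `M = 0` gives flat data on `E3` minus a disc. The slice is
spacelike and, for `r₀ < r₊`, **horizon-penetrating**, but it is **not a Cauchy hypersurface**
of `Kerr.region a r₀` (causal curves may leave through `{r = r₀}` before `{t* = 0}`); statements
downstream use only *developments* of these data (review F5). Instance hypotheses `[Kerr.Facts]`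
(the metric) and `[Kerr.SliceFacts]` (connectedness, `hpb`, Levi-Civita, spacelikeness, symmetry
and smoothness of `k`; M5 migration). [cite: ONeill1995, Ch. 2  Dafermos–Rodnianski arXiv:0811.03] -/
def data [Facts] [SliceFacts] (M a r₀ : ℝ) (hM : 0 ≤ M) : InitialDataSet 𝓘(ℝ, E3) (slice a r₀) where
  h := (smoothMetric M a r₀).inducedRiemannianMetric (sliceEmbed a r₀)
    (SliceFacts.contMDiff_pullbackBilin a r₀) (SliceFacts.isSpacelikeImmersion_sliceEmbed M a r₀ hM)
  k := sliceK M a r₀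
  k_symm := SliceFacts.sliceK_symm M a r₀ hM
  contMDiff_k := SliceFacts.contMDiff_sliceK M a r₀ hM

/-- The metric of the Kerr data at `y` is the induced form `g((0,v), (0,w))` at `(0, y)`, i.e.
`h = δ + 2H ℓ⃗ ⊗ ℓ⃗` (Cook 2000, §3.2.2, (55)). [cite: Cook2000, §3.2.2  (55] -/
@[simp]
theorem data_h_inner [Facts] [SliceFacts] (M a r₀ : ℝ) (hM : 0 ≤ M) (y : slice a r₀) :
    (data M a r₀ hM).h.inner y =
      (smoothMetric M a r₀).inducedBilin 𝓘(ℝ, E3) (sliceEmbed a r₀) y :=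
  rfl

/-- The tensor `k` of the Kerr data is `Kerr.sliceK` (Cook 2000, §3.2.2, (57)). [cite: Cook2000, §3.2.2  (57] -/
@[simp]
theorem data_k [Facts] [SliceFacts] (M a r₀ : ℝ) (hM : 0 ≤ M) :
    (data M a r₀ hM).k = sliceK M a r₀ := rfl

/-- The Kerr data solve the **vacuum constraint equations** (Gauss–Codazzi for a spacelike slice
of the Ricci-flat Kerr metric, `Kerr.isRicciFlat`). Choquet-Bruhat 2009, Ch. VI, Thm. 3.3;
García-Parrado–Valiente Kroon 2008, §5. Named fact (D-0014); `0 ≤ M` is the leading binder and it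
binds the standing hypothesis `[(data …).metric.HasLeviCivita]` of the constraint functions
(`InitialData.lean`), as `Kerr.isRicciFlat` does. [cite: ChoquetBruhat2009, Ch. VI  Thm. 3.3] -/
def data_isVacuumConstraintSolution [Facts] [SliceFacts] (M a r₀ : ℝ) : Prop :=
  ∀ (hM : 0 ≤ M) [(data M a r₀ hM).metric.HasLeviCivita],
    (data M a r₀ hM).IsVacuumConstraintSolution

/-! ### The asymptotically flat end of the slice -/

/-- The inner coordinate radius `R = √((max r₀ 0)² + a²) + 1` of the asymptotically flat end
of `Kerr.slice a r₀`: beyond it, `‖y‖ > R` forces `r > max r₀ 0` (`mem_slice_of_lt_norm`).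
Bartnik, CPAM 39 (1986), §1; Dafermos–Rodnianski arXiv:0811.0354, §5.1. [cite: arXiv08110354] -/
def afRadius (a r₀ : ℝ) : ℝ := √((max r₀ 0) ^ 2 + a ^ 2) + 1

/-- The inner radius of the Kerr end is positive (Bartnik 1986, §1). [cite: Bartnik1986, §1] -/
theorem afRadius_pos (a r₀ : ℝ) : 0 < afRadius a r₀ := by
  unfold afRadius
  positivity

/-- `|a| < R`: the end lies outside the singular disc `{z = 0, ρ ≤ |a|}` (Bartnik 1986, §1;
Visser arXiv:0706.0622, (35)). [cite: Bartnik1986, §1] -/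
theorem abs_lt_afRadius (a r₀ : ℝ) : |a| < afRadius a r₀ := by
  unfold afRadius
  have h1 : |a| ≤ √((max r₀ 0) ^ 2 + a ^ 2) := by
    rw [← Real.sqrt_sq_eq_abs]
    exact Real.sqrt_le_sqrt (by nlinarith [sq_nonneg (max r₀ 0)])
  linarith

/-- **Membership fact of the end.** If `‖x‖ > R = √((max r₀ 0)² + a²) + 1` then
`(0, x) ∈ Kerr.region a r₀`, i.e. `x ∈ Kerr.slice a r₀`: from the quartic,
`r² ≥ ‖x‖² − a² > (max r₀ 0)²` (and `r > 0` since `x` is off the disc `ρ ≤ |a|`). True for all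
`a, r₀`. Visser arXiv:0706.0622, (35); Dafermos–Rodnianski arXiv:0811.0354, §5.1. [cite: arXiv07060622] -/
theorem mem_slice_of_lt_norm {a r₀ : ℝ} {x : E3} (hx : afRadius a r₀ < ‖x‖) :
    x ∈ slice a r₀ := by
  set m := max r₀ 0 with hm_def
  have hm : 0 ≤ m := le_max_right _ _
  have hR : √(m ^ 2 + a ^ 2) < ‖x‖ := by
    have : √(m ^ 2 + a ^ 2) < afRadius a r₀ := by unfold afRadius; linarith
    exact this.trans hx
  have hsq : m ^ 2 + a ^ 2 < ‖x‖ ^ 2 := by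
    have h0 : 0 ≤ √(m ^ 2 + a ^ 2) := Real.sqrt_nonneg _
    have := Real.sq_sqrt (by positivity : 0 ≤ m ^ 2 + a ^ 2)
    nlinarith
  rw [mem_slice, ← hm_def, radius, E4.spatialNorm_ofTimeSpace]
  refine (Real.lt_sqrt hm).mpr ?_
  have h1 : ‖x‖ ^ 2 - a ^ 2 ≤ √((‖x‖ ^ 2 - a ^ 2) ^ 2 + 4 * a ^ 2 * E4.ofTimeSpace 0 x 3 ^ 2) := by
    calc ‖x‖ ^ 2 - a ^ 2 = √((‖x‖ ^ 2 - a ^ 2) ^ 2) := by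
          rw [Real.sqrt_sq]; nlinarith
      _ ≤ _ := Real.sqrt_le_sqrt (by nlinarith [sq_nonneg (a * E4.ofTimeSpace 0 x 3)])
  linarith

/-- The open end `U = {y ∈ Kerr.slice a r₀ | R < ‖y‖}` (as an open subset of the slice).
Bartnik 1986, §1. [cite: Bartnik1986, §1] -/
def afU (a r₀ : ℝ) : Opens (slice a r₀) :=
  ⟨{y | afRadius a r₀ < ‖(y : E3)‖},
    isOpen_lt continuous_const (continuous_norm.comp continuous_subtype_val)⟩

/-- Membership in the open end `Kerr.afU` (Bartnik 1986, §1). [cite: Bartnik1986, §1] -/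
@[simp]
theorem mem_afU {a r₀ : ℝ} {y : slice a r₀} : y ∈ afU a r₀ ↔ afRadius a r₀ < ‖(y : E3)‖ :=
  Iff.rfl

/-- The tautological bijection `U ≃ {x : E3 | R < ‖x‖}`, `y ↦ y` (both are the same subset of
`E3`, by `mem_slice_of_lt_norm`); both inverse laws hold by `rfl`. Bartnik 1986, §1 (structure
of infinity). [cite: Bartnik1986, §1 (structure of infinity] -/
def afChartEquiv (a r₀ : ℝ) : afU a r₀ ≃ exteriorRegion (afRadius a r₀) where
  toFun y := ⟨y.1.1, y.2⟩
  invFun x := ⟨⟨x.1, mem_slice_of_lt_norm x.2⟩, x.2⟩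
  left_inv _ := rfl
  right_inv _ := rfl

/-- Unfolding lemma: the chart of the Kerr end is the identity on coordinates
(Bartnik 1986, §1). [cite: Bartnik1986, §1] -/
@[simp]
theorem coe_afChartEquiv (a r₀ : ℝ) (y : afU a r₀) : (afChartEquiv a r₀ y : E3) = y := rfl

/-- Unfolding lemma: the inverse chart of the Kerr end is the identity on coordinates
(Bartnik 1986, §1). [cite: Bartnik1986, §1] -/
@[simp]
theorem coe_coe_afChartEquiv_symm (a r₀ : ℝ) (x : exteriorRegion (afRadius a r₀)) :
    (((afChartEquiv a r₀).symm x : slice a r₀) : E3) = x := rfl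

/-- The chart of the Kerr end is smooth (it is the identity in the ambient coordinates of two
nested open submanifolds of `E3`: its composite with the inclusion into `E3` is the composite of
two open-submanifold inclusions). Bartnik 1986, §1. [cite: Bartnik1986, §1] -/
theorem contMDiff_afChartEquiv (a r₀ : ℝ) :
    ContMDiff (𝓡 3) (𝓡 3) ∞ (afChartEquiv a r₀) := by
  have h : ContMDiff (𝓡 3) (𝓡 3) ∞ (fun y : afU a r₀ ↦ ((y : slice a r₀) : E3)) :=
    contMDiff_subtype_val.comp contMDiff_subtype_val
  exact (ContMDiff.subtypeVal_comp_iff _ _).mp h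

/-- The inverse chart of the Kerr end is smooth (identity in ambient coordinates: its composite
with the two inclusions `afU ⊆ slice ⊆ E3` is the inclusion of `exteriorRegion R`).
Bartnik 1986, §1. [cite: Bartnik1986, §1] -/
theorem contMDiff_afChartEquiv_symm (a r₀ : ℝ) :
    ContMDiff (𝓡 3) (𝓡 3) ∞ (afChartEquiv a r₀).symm :=
  (ContMDiff.subtypeVal_comp_iff _ _).mp <|
    (ContMDiff.subtypeVal_comp_iff _ _).mp contMDiff_subtype_val

/-- The chart `U ≅ {x : E3 | R < ‖x‖}` of the Kerr end as a diffeomorphism.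
Bartnik 1986, §1. [cite: Bartnik1986, §1] -/
def afChart (a r₀ : ℝ) :
    Diffeomorph (𝓡 3) (𝓡 3) (afU a r₀) (exteriorRegion (afRadius a r₀)) ∞ where
  toEquiv := afChartEquiv a r₀
  contMDiff_toFun := contMDiff_afChartEquiv a r₀
  contMDiff_invFun := contMDiff_afChartEquiv_symm a r₀

/-- The Kerr end is closed at infinity: for `R' > R` the set `{y ∈ slice | R' ≤ ‖y‖}` (which
is the image of `chart⁻¹ {R' ≤ ‖x‖}`) is closed in `Kerr.slice a r₀`. Bartnik 1986, §1. [cite: Bartnik1986, §1] -/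
theorem isClosed_far_afChart (a r₀ : ℝ) (R' : ℝ) (hR' : afRadius a r₀ < R') :
    IsClosed (((↑) : afU a r₀ → slice a r₀) ''
      (afChart a r₀ ⁻¹' {x | R' ≤ ‖(x : E3)‖})) := by
  have key : ((↑) : afU a r₀ → slice a r₀) '' (afChart a r₀ ⁻¹' {x | R' ≤ ‖(x : E3)‖}) =
      {y : slice a r₀ | R' ≤ ‖(y : E3)‖} := by
    ext y
    constructor
    · rintro ⟨z, hz, rfl⟩
      exact hz
    · intro hy
      exact ⟨⟨y, hR'.trans_le hy⟩, hy, rfl⟩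
  rw [key]
  exact isClosed_le continuous_const (continuous_norm.comp continuous_subtype_val)

/-- The **asymptotically flat end** of the Kerr–Schild slice: `U = {y ∈ slice | R < ‖y‖}`,
`R = √((max r₀ 0)² + a²) + 1`, with the tautological chart onto `{x : E3 | R < ‖x‖}`
(open-end design of `AFEnd`; the slice `≅ (max r₀ 0, ∞) × S²` has no compact core).
Bartnik, CPAM 39 (1986), §1; Dafermos–Rodnianski arXiv:0811.0354, §5.1. [cite: arXiv08110354] -/
def afEnd (a r₀ : ℝ) : AFEnd (slice a r₀) where
  U := afU a r₀
  R := afRadius a r₀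
  R_pos := afRadius_pos a r₀
  chart := afChart a r₀
  isClosed_far := isClosed_far_afChart a r₀

/-- The inner radius of `Kerr.afEnd` is `Kerr.afRadius` (by `rfl`). Bartnik 1986, §1. [cite: Bartnik1986, §1] -/
@[simp]
theorem afEnd_R (a r₀ : ℝ) : (afEnd a r₀).R = afRadius a r₀ := rfl

/-! ### Asymptotic flatness and ADM quantities of the Kerr data -/

/-- The Kerr data are **asymptotically flat of order `1`** on the end `Kerr.afEnd a r₀`:
in Kerr–Schild Cartesian coordinates `h − δ = 2H ℓ⃗ ⊗ ℓ⃗ = O₂(r⁻¹)` (`H = M/r + O(r⁻³)`,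
`ℓ⃗ = x̂ + O(r⁻¹)`) and `k = O₁(r⁻²)`. Bartnik 1986, Def. 2.1; Cook 2000, §3.2.2;
García-Parrado–Valiente Kroon 2008, §5. Named fact (D-0014; `0 ≤ M` is the leading binder). [cite: Bartnik1986, Def. 2.1] -/
def isAsymptoticallyFlat_data [Facts] [SliceFacts] (M a r₀ : ℝ) : Prop :=
  ∀ hM : 0 ≤ M, (afEnd a r₀).IsAsymptoticallyFlat (data M a r₀ hM) 1

/-- The Kerr data are **not** strongly asymptotically flat in the sense of Dafermos–Rodnianski
(App. B.2.3: `k = o₁(r⁻²)`) on the Kerr–Schild end, for `M > 0` and any mass parameter: on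
Kerr–Schild slices `tr_h k = (2M/r²)(1 + 3M/r)(1 + 2M/r)^{-3/2} + O(r⁻³)`, so `‖k‖` is not
`o(r⁻²)`. (This replaces the outline's planned `isStronglyAsymptoticallyFlatDR_data`, which is
false; see the module docstring.) Cook, Living Rev. Relativ. 3 (2000) 5, §3.2.2, (58);
Dafermos–Rodnianski arXiv:0811.0354, App. B.2.3. Named fact (D-0014; `0 < M` and the mass
parameter `M'` are leading binders). [cite: arXiv08110354] -/
def not_isStronglyAsymptoticallyFlatDR_data [Facts] [SliceFacts] (M a r₀ : ℝ) : Prop :=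
  ∀ (hM : 0 < M) (M' : ℝ), ¬ (afEnd a r₀).IsStronglyAsymptoticallyFlatDR (data M a r₀ hM.le) M'

/-- The Kerr data have **ADM energy `M`** on the end `Kerr.afEnd a r₀`: with
`h_ij = δ_ij + 2M xᵢxⱼ/r³ + O(r⁻²)`, `∑ᵢⱼ (∂ⱼ h_ij − ∂ᵢ h_jj) xⁱ/r = 4M/r² + O(r⁻³)`, whose flux
through `‖x‖ = r` tends to `16π M`. Arnowitt–Deser–Misner 1962; Bartnik 1986, (4.2);
Visser arXiv:0706.0622, §5. Named fact (D-0014; `0 ≤ M` is the leading binder). [cite: ArnowittDeserMisner1962] -/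
def hasADMEnergy_data [Facts] [SliceFacts] (M a r₀ : ℝ) : Prop :=
  ∀ hM : 0 ≤ M, (afEnd a r₀).HasADMEnergy (data M a r₀ hM) M

/-- The ADM energy of the Kerr data is `M` (from the named fact `hasADMEnergy_data`, taken as
the hypothesis `hE`). Bartnik 1986, (4.2). [cite: Bartnik1986, (4.2] -/
theorem admEnergy_data [Facts] [SliceFacts] {M : ℝ} (hM : 0 ≤ M) (a r₀ : ℝ)
    (hE : hasADMEnergy_data M a r₀) :
    (afEnd a r₀).admEnergy (data M a r₀ hM) = M :=
  (hE hM).admEnergy_eq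

/-- The Kerr data have **vanishing ADM linear momentum** on the Kerr–Schild end (the leading
`O(r⁻²)` part of `k_ij − (tr k) h_ij` is the spherically symmetric Schwarzschild one, whose flux
integrand is odd; the `a`-dependent corrections are `O(r⁻³)`). Arnowitt–Deser–Misner 1962;
Bartnik–Isenberg 2004, §2; García-Parrado–Valiente Kroon 2008, §5. Named fact (D-0014; `0 ≤ M`
and the component index `i` are leading binders). [cite: ArnowittDeserMisner1962] -/
def hasADMMomentum_data_zero [Facts] [SliceFacts] (M a r₀ : ℝ) : Prop :=
  ∀ (hM : 0 ≤ M) (i : Fin 3), (afEnd a r₀).HasADMMomentum (data M a r₀ hM) i 0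

/-- The ADM linear momentum of the Kerr data vanishes (from the named fact
`hasADMMomentum_data_zero`, taken as the hypothesis `hP`). Arnowitt–Deser–Misner 1962;
Bartnik–Isenberg 2004, §2. [cite: ArnowittDeserMisner1962] -/
theorem admMomentum_data_eq_zero [Facts] [SliceFacts] {M : ℝ} (hM : 0 ≤ M) (a r₀ : ℝ)
    (hP : hasADMMomentum_data_zero M a r₀) (i : Fin 3) :
    (afEnd a r₀).admMomentum (data M a r₀ hM) i = 0 :=
  (hP hM i).admMomentum_eq

/-- The ADM mass `√(E² − |P|²)` of the Kerr data is `M` (`E = M ≥ 0`, `P = 0`; from the named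
facts `hasADMEnergy_data`, `hasADMMomentum_data_zero`, taken as hypotheses).
Arnowitt–Deser–Misner 1962; Bartnik 1986, Thm. 4.2. [cite: ArnowittDeserMisner1962] -/
theorem admMass_data [Facts] [SliceFacts] {M : ℝ} (hM : 0 ≤ M) (a r₀ : ℝ)
    (hE : hasADMEnergy_data M a r₀) (hP : hasADMMomentum_data_zero M a r₀) :
    (afEnd a r₀).admMass (data M a r₀ hM) = M := by
  simp [AFEnd.admMass, admEnergy_data hM a r₀ hE, admMomentum_data_eq_zero hM a r₀ hP,
    Real.sqrt_sq hM]

end Kerr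

end Literature.Geometry.Lorentzian

end
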